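import Summits.Ventures.CertifiedArithmetic.LowPrec.SRScaleSelect
import HarnessLib

/-!
# Block-scaled quantisation under stochastic rounding, IV: the MSE side of scale selection
(file LIV)

HONEST FRAMING: certified error envelopes and provably optimal rounding/accumulation schemes for
low-precision formats under stated cost models; every table by two implementations; no hardware or
vendor claims.

File LIII (`SRScaleSelect`) showed that REALISED-ERROR scale selection between two stochastic
roundings ("4/6" with SR, [CookEtAl2025] §3 / App. A.3; [PanferovEtAl2026] §4.2) is biased, with
exact witnesses, while INPUT-MEASURABLE selection (e.g. by the exact conditional SR variance) is
unbiased.  This file proves the other half of the trade, for EVERY finite format `F` in any linear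
ordered field, every pair of scales, every input and every test point — the exact content of
Cook et al.'s remark that the bias is "reintroduced in a way that favors reduced quantization
error":

* `selStep_sq_le_left` / `selStep_sq_le_right` / `selStep_sq_le_min` — the MSE of realised
  selection never exceeds the SR second moment of EITHER scale (no admissibility needed; when both
  scales are admissible these are the two SR variances): `E min ≤ min E`;
* `coupling_sq_le_left` / `coupling_sq_le_right` — the same for EVERY joint law of the two
  roundings (shared, antithetic or independent random bits), as a termwise inequality over an
  arbitrary finitely supported coupling — the MSE companion of `FP4Sel.any_coupling`;
* `step_sq_jensen`, `selStep_bias_sq_le` — the squared bias of realised selection never exceeds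
  its MSE (two-stage Jensen), hence never exceeds the smaller SR variance;
* `blockStep_mono`, `blockStep_const`, `step_add_const_left` / `blockStep_const_add`, `blockStep_sse` — the independent
  block law of LIII is monotone and affine in the test function and its expected realised SSE is
  the SUM of the elementwise SR second moments; `blockSel_sse_le_left` / `_right` / `_min` — the
  published BLOCK rule (keep the copy with the smaller realised sum of squared errors) has expected
  SSE at most the smaller of the two blocks' expected SSEs;
* `FP4Sel.trade` — the numbers on the LIII witness block `(6, 11/2)` in E2M1 with scales `1` and
  `3/2`: expected block SSE `3/4` at scale `1`, `1/2` at scale `3/2`, `5/16` under realised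
  selection; squared bias `9/64 ≤ 5/16 ≤ 1/2` (kernel-checked).

So, exactly: realised selection is a SHRINKAGE-type estimator — never worse in MSE than the better
single scale, generically biased (LIII); the conditional-variance rule of LIII is unbiased and
MSE-optimal among input-measurable two-scale rules (`blockVar_varSel_le`), and its MSE is `≥` that
of realised selection.  Which to use is decided by what the pipeline needs from SR — unbiased
gradient estimates ([ConnollyHighamMary2021] §1, the reason SR is used in training at all) or least
squared error — and both sides of that choice are now theorems rather than experiments.  No
hardware or vendor claim is made; "4/6" enters only as the mathematical selection rule.
-/

namespace Summit.Ventures.CertifiedArithmetic.LowPrec.SR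

open Literature.ComputerArithmetic.FloatingPoint
open Finset

/-! ## Realised selection never increases the squared error -/

section Generic

variable {K : Type*} [Field K] [LinearOrder K] [IsStrictOrderedRing K]

omit [IsStrictOrderedRing K] in
/-- The kept candidate is at least as close to `v` as the first candidate. -/
theorem pickNearer_abs_le_left (v a b : K) : |pickNearer v a b - v| ≤ |a - v| := by
  unfold pickNearer
  split_ifs with h
  · exact h.le
  · exact le_rfl

omit [IsStrictOrderedRing K] in
/-- The kept candidate is at least as close to `v` as the second candidate. -/
theorem pickNearer_abs_le_right (v a b : K) : |pickNearer v a b - v| ≤ |b - v| := by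
  unfold pickNearer
  split_ifs with h
  · exact le_rfl
  · exact not_lt.mp h

/-- Squared-error form of `pickNearer_abs_le_left`. -/
theorem pickNearer_sq_le_left (v a b : K) : (pickNearer v a b - v) ^ 2 ≤ (a - v) ^ 2 :=
  sq_le_sq.mpr (pickNearer_abs_le_left v a b)

/-- Squared-error form of `pickNearer_abs_le_right`. -/
theorem pickNearer_sq_le_right (v a b : K) : (pickNearer v a b - v) ^ 2 ≤ (b - v) ^ 2 :=
  sq_le_sq.mpr (pickNearer_abs_le_right v a b)

/-- **`E min ≤ E₁`**: the MSE of realised selection is at most the SR second moment about `v` at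
the first scale (its SR variance when `s₁` is admissible).  Any finite format, any scales. -/
theorem selStep_sq_le_left (F : Finset K) (s₁ s₂ v : K) :
    selStep F s₁ s₂ v (fun y => (y - v) ^ 2) ≤ scaledStep F s₁ v (fun y => (y - v) ^ 2) := by
  unfold selStep scaledStep
  refine step_mono F (v / s₁) fun t => ?_
  calc step F (v / s₂) (fun u => (pickNearer v (s₁ * t) (s₂ * u) - v) ^ 2)
      ≤ step F (v / s₂) (fun _ => (s₁ * t - v) ^ 2) :=
        step_mono F (v / s₂) fun u => pickNearer_sq_le_left v _ _
    _ = (s₁ * t - v) ^ 2 := step_const F _ _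

/-- **`E min ≤ E₂`**: the MSE of realised selection is at most the SR second moment about `v` at
the second scale. -/
theorem selStep_sq_le_right (F : Finset K) (s₁ s₂ v : K) :
    selStep F s₁ s₂ v (fun y => (y - v) ^ 2) ≤ scaledStep F s₂ v (fun y => (y - v) ^ 2) := by
  unfold selStep scaledStep
  calc step F (v / s₁) (fun t => step F (v / s₂) (fun u => (pickNearer v (s₁ * t) (s₂ * u) - v) ^ 2))
      ≤ step F (v / s₁) (fun _ => step F (v / s₂) (fun u => (s₂ * u - v) ^ 2)) :=
        step_mono F (v / s₁) fun t => step_mono F (v / s₂) fun u => pickNearer_sq_le_right v _ _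
    _ = step F (v / s₂) (fun u => (s₂ * u - v) ^ 2) := step_const F _ _

/-- **`E min ≤ min E`** (element form). -/
theorem selStep_sq_le_min (F : Finset K) (s₁ s₂ v : K) :
    selStep F s₁ s₂ v (fun y => (y - v) ^ 2)
      ≤ min (scaledStep F s₁ v (fun y => (y - v) ^ 2)) (scaledStep F s₂ v (fun y => (y - v) ^ 2)) :=
  le_min (selStep_sq_le_left F s₁ s₂ v) (selStep_sq_le_right F s₁ s₂ v)

/-- **Every coupling, first marginal**: for ANY finitely supported joint weights `p i j ≥ 0` on
pairs of candidates `(x i, y j)` — shared, antithetic or independent random bits alike — the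
expected squared error of the nearer candidate is at most that of the first coordinate.  (With
`Σⱼ p i j` = the SR law of scale one this is "MSE of realised selection ≤ variance of scale one"
for every coupling; cf. `FP4Sel.any_coupling` for the bias side.) -/
theorem coupling_sq_le_left {ι κ : Type*} (I : Finset ι) (J : Finset κ) (p : ι → κ → K)
    (hp : ∀ i j, 0 ≤ p i j) (x : ι → K) (y : κ → K) (v : K) :
    ∑ i ∈ I, ∑ j ∈ J, p i j * (pickNearer v (x i) (y j) - v) ^ 2
      ≤ ∑ i ∈ I, ∑ j ∈ J, p i j * (x i - v) ^ 2 :=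
  sum_le_sum fun i _ => sum_le_sum fun j _ =>
    mul_le_mul_of_nonneg_left (pickNearer_sq_le_left v _ _) (hp i j)

/-- **Every coupling, second marginal**. -/
theorem coupling_sq_le_right {ι κ : Type*} (I : Finset ι) (J : Finset κ) (p : ι → κ → K)
    (hp : ∀ i j, 0 ≤ p i j) (x : ι → K) (y : κ → K) (v : K) :
    ∑ i ∈ I, ∑ j ∈ J, p i j * (pickNearer v (x i) (y j) - v) ^ 2
      ≤ ∑ i ∈ I, ∑ j ∈ J, p i j * (y j - v) ^ 2 :=
  sum_le_sum fun i _ => sum_le_sum fun j _ =>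
    mul_le_mul_of_nonneg_left (pickNearer_sq_le_right v _ _) (hp i j)

/-! ## Squared bias ≤ MSE (two-stage Jensen) -/

/-- **One-step Jensen for the square**: `(E g(SR c) - v)² ≤ E (g(SR c) - v)²` for every test
function `g` (the SR weights lie in `[0, 1]`). -/
theorem step_sq_jensen (F : Finset K) (c v : K) (g : K → K) :
    (step F c g - v) ^ 2 ≤ step F c (fun t => (g t - v) ^ 2) := by
  unfold step
  have hp := pUp_nonneg F c
  have hq : 0 ≤ 1 - pUp F c := sub_nonneg.mpr (pUp_le_one F c)
  -- two-point identity: (p x + (1-p) y - v)² = p (x-v)² + (1-p) (y-v)² - p (1-p) (x-y)²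
  have key : (pUp F c * g (up F c) + (1 - pUp F c) * g (dn F c) - v) ^ 2
      = pUp F c * (g (up F c) - v) ^ 2 + (1 - pUp F c) * (g (dn F c) - v) ^ 2
        - pUp F c * (1 - pUp F c) * (g (up F c) - g (dn F c)) ^ 2 := by ring
  rw [key]
  have := mul_nonneg (mul_nonneg hp hq) (sq_nonneg (g (up F c) - g (dn F c)))
  linarith

/-- **Squared bias of realised selection ≤ its MSE** (two-stage Jensen), hence, by
`selStep_sq_le_min`, at most the smaller SR second moment: the bias that realised selection
introduces is never larger than the standard deviation of the better scale. -/
theorem selStep_bias_sq_le (F : Finset K) (s₁ s₂ v : K) :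
    (selStep F s₁ s₂ v (fun y => y) - v) ^ 2 ≤ selStep F s₁ s₂ v (fun y => (y - v) ^ 2) := by
  unfold selStep scaledStep
  calc (step F (v / s₁) (fun t => step F (v / s₂) (fun u => pickNearer v (s₁ * t) (s₂ * u))) - v) ^ 2
      ≤ step F (v / s₁) (fun t => (step F (v / s₂) (fun u => pickNearer v (s₁ * t) (s₂ * u)) - v) ^ 2) :=
        step_sq_jensen F _ v _
    _ ≤ step F (v / s₁) (fun t => step F (v / s₂) (fun u => (pickNearer v (s₁ * t) (s₂ * u) - v) ^ 2)) :=
        step_mono F _ fun t => step_sq_jensen F _ v _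

/-- **The trade, element form**: squared bias ≤ MSE ≤ min of the two SR second moments. -/
theorem selStep_bias_sq_le_min (F : Finset K) (s₁ s₂ v : K) :
    (selStep F s₁ s₂ v (fun y => y) - v) ^ 2
      ≤ min (scaledStep F s₁ v (fun y => (y - v) ^ 2)) (scaledStep F s₂ v (fun y => (y - v) ^ 2)) :=
  (selStep_bias_sq_le F s₁ s₂ v).trans (selStep_sq_le_min F s₁ s₂ v)

/-! ## Block form: the independent block law and the realised-SSE rule -/

/-- The block law is monotone in the test function. -/
theorem blockStep_mono (F : Finset K) (s : K) :
    ∀ (V : List K) {g h : List K → K}, (∀ A, g A ≤ h A) → blockStep F s V g ≤ blockStep F s V h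
  | [], _, _, hgh => hgh []
  | v :: V, _, _, hgh => by
    unfold blockStep scaledStep
    exact step_mono F _ fun t => blockStep_mono F s V fun A => hgh (s * t :: A)

omit [IsStrictOrderedRing K] in
/-- The block law of a constant test function is that constant. -/
theorem blockStep_const (F : Finset K) (s : K) :
    ∀ (V : List K) (a : K), blockStep F s V (fun _ => a) = a
  | [], _ => rfl
  | v :: V, a => by
    unfold blockStep scaledStep
    simp_rw [blockStep_const F s V a]
    exact step_const F _ _

omit [IsStrictOrderedRing K] in
/-- One-step expectation is affine in the test function: `E (a + f(SR c)) = a + E f(SR c)`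
(from `step_add` and `step_const`; cf. `step_const_add` of `SRTwoSum`, the case `f = id`). -/
theorem step_add_const_left (F : Finset K) (c a : K) (f : K → K) :
    step F c (fun t => a + f t) = a + step F c f := by
  rw [step_add F c (fun _ => a) f, step_const]

omit [IsStrictOrderedRing K] in
/-- The block law is affine: `E (a + g) = a + E g`. -/
theorem blockStep_const_add (F : Finset K) (s : K) :
    ∀ (V : List K) (a : K) (g : List K → K),
      blockStep F s V (fun A => a + g A) = a + blockStep F s V g
  | [], _, _ => rfl
  | v :: V, a, g => by
    unfold blockStep scaledStep
    simp_rw [blockStep_const_add F s V a]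
    exact step_add_const_left F _ _ _

omit [IsStrictOrderedRing K] in
/-- **Expected realised SSE of one stochastically rounded copy = the SUM of the elementwise SR
second moments** (independence is not even needed for this — linearity): for admissible `s` this
is the block SR variance `Σᵢ s²·v_F(Vᵢ/s)` of LIII's `blockVar`. -/
theorem blockStep_sse (F : Finset K) (s : K) :
    ∀ V : List K, blockStep F s V (fun A => sse A V)
      = (V.map fun v => scaledStep F s v (fun y => (y - v) ^ 2)).sum
  | [] => rfl
  | v :: V => by
    rw [List.map_cons, List.sum_cons, blockStep]
    have inner : ∀ y, blockStep F s V (fun ys => sse (y :: ys) (v :: V))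
        = (y - v) ^ 2 + (V.map fun v => scaledStep F s v (fun y => (y - v) ^ 2)).sum := by
      intro y
      show blockStep F s V (fun ys => (y - v) ^ 2 + sse ys V) = _
      rw [blockStep_const_add, blockStep_sse F s V]
    simp_rw [inner]
    unfold scaledStep
    rw [show (fun t => (s * t - v) ^ 2 + (V.map fun v => step F (v / s) fun t => (s * t - v) ^ 2).sum)
        = (fun t => (V.map fun v => step F (v / s) fun t => (s * t - v) ^ 2).sum + (s * t - v) ^ 2)
        from funext fun t => add_comm _ _, step_add_const_left, add_comm]

omit [IsStrictOrderedRing K] in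
/-- The kept copy has realised SSE at most that of the first copy. -/
theorem sse_sel_le_left (A B V : List K) :
    sse (if sse B V < sse A V then B else A) V ≤ sse A V := by
  split_ifs with h
  · exact h.le
  · exact le_rfl

omit [IsStrictOrderedRing K] in
/-- The kept copy has realised SSE at most that of the second copy. -/
theorem sse_sel_le_right (A B V : List K) :
    sse (if sse B V < sse A V then B else A) V ≤ sse B V := by
  split_ifs with h
  · exact le_rfl
  · exact not_lt.mp h

/-- **`E min SSE ≤ E SSE₁`** for the published block rule. -/
theorem blockSel_sse_le_left (F : Finset K) (s₁ s₂ : K) (V : List K) :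
    blockSel F s₁ s₂ V (fun A => sse A V) ≤ blockStep F s₁ V (fun A => sse A V) := by
  unfold blockSel
  refine blockStep_mono F s₁ V fun A => ?_
  calc blockStep F s₂ V (fun B => sse (if sse B V < sse A V then B else A) V)
      ≤ blockStep F s₂ V (fun _ => sse A V) := blockStep_mono F s₂ V fun B => sse_sel_le_left A B V
    _ = sse A V := blockStep_const F s₂ V _

/-- **`E min SSE ≤ E SSE₂`** for the published block rule. -/
theorem blockSel_sse_le_right (F : Finset K) (s₁ s₂ : K) (V : List K) :
    blockSel F s₁ s₂ V (fun A => sse A V) ≤ blockStep F s₂ V (fun A => sse A V) := by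
  unfold blockSel
  calc blockStep F s₁ V (fun A => blockStep F s₂ V (fun B => sse (if sse B V < sse A V then B else A) V))
      ≤ blockStep F s₁ V (fun _ => blockStep F s₂ V (fun B => sse B V)) :=
        blockStep_mono F s₁ V fun A => blockStep_mono F s₂ V fun B => sse_sel_le_right A B V
    _ = blockStep F s₂ V (fun B => sse B V) := blockStep_const F s₁ V _

/-- **`E min SSE ≤ min (E SSE₁, E SSE₂) = min of the two sums of elementwise SR second moments**:
realised-SSE selection is never worse in expected squared error than the better single scale —
for every finite format, every pair of scales and every block. -/
theorem blockSel_sse_le_min (F : Finset K) (s₁ s₂ : K) (V : List K) :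
    blockSel F s₁ s₂ V (fun A => sse A V)
      ≤ min (V.map fun v => scaledStep F s₁ v (fun y => (y - v) ^ 2)).sum
            (V.map fun v => scaledStep F s₂ v (fun y => (y - v) ^ 2)).sum := by
  rw [← blockStep_sse, ← blockStep_sse]
  exact le_min (blockSel_sse_le_left F s₁ s₂ V) (blockSel_sse_le_right F s₁ s₂ V)

end Generic

/-! ## The numbers on the LIII witness block -/

namespace FP4Sel

/-- **The trade on the block `(6, 11/2)` in E2M1 with the 4/6 scales `1` and `3/2`** (LIII's
witness; kernel evaluation over the literal table `FP4.e2m1`): expected block SSE `3/4` at scale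
`1` and `1/2` at scale `3/2` (the element `6` is exact under both, so these are the second
element's SR variances), `5/16` under realised-SSE selection with either default; and the chain
squared bias `(47/8 - 11/2)² = 9/64 ≤ 5/16 ≤ 1/2 = min (3/4, 1/2)` — strict at both ends. -/
theorem trade :
    blockStep FP4.e2m1 1 [6, 11 / 2] (fun A => sse A [6, 11 / 2]) = 3 / 4
    ∧ blockStep FP4.e2m1 (3 / 2) [6, 11 / 2] (fun A => sse A [6, 11 / 2]) = 1 / 2
    ∧ blockSel FP4.e2m1 1 (3 / 2) [6, 11 / 2] (fun A => sse A [6, 11 / 2]) = 5 / 16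
    ∧ blockSel FP4.e2m1 (3 / 2) 1 [6, 11 / 2] (fun A => sse A [6, 11 / 2]) = 5 / 16
    ∧ (selStep FP4.e2m1 1 (3 / 2) (11 / 2) (fun y => y) - 11 / 2) ^ 2 = 9 / 64
    ∧ ((9 : ℚ) / 64 < 5 / 16 ∧ (5 : ℚ) / 16 < 1 / 2) := by
  refine ⟨?_, ?_, ?_, ?_, ?_, by norm_num⟩ <;> decide +kernel

/-- The same block SSE facts over the format's value set `MiniFloat.valueSet E2M1`. -/
theorem valueSet_trade :
    blockSel (MiniFloat.valueSet Format.E2M1) 1 (3 / 2) [6, 11 / 2] (fun A => sse A [6, 11 / 2])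
        = 5 / 16
    ∧ blockStep (MiniFloat.valueSet Format.E2M1) (3 / 2) [6, 11 / 2] (fun A => sse A [6, 11 / 2])
        = 1 / 2 := by
  rw [← e2m1_eq_valueSet]
  exact ⟨trade.2.2.1, trade.2.1⟩

end FP4Sel

end Summit.Ventures.CertifiedArithmetic.LowPrec.SR
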